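import Summits.BirchSwinnertonDyer.Rank1Residual.Supersingular.MazurTateTwistedNonvanishingComplex
import HarnessLib

/-!
# A Mazur–Tate certificate forbids vanishing twists, part 3: no Mordell–Weil growth in the layer
# `ℚ_n ⊂ ℚ(ζ_{p^{n+1}})` of the cyclotomic `ℤ_p`-tower (under Kato's Cor. 14.3 (2))
# (cell `b2b-bsdres`, supersingular family, prover B = unit `b2b-bsdres-additive-p3`, gen 6; part 3)

HONEST FRAMING (run/shared/lean/b2b/bsd-rank1-residual/, verbatim in every file): the goal of the
cell is to DELETE the COMBINATION-SHAPED residual classes of the Birch–Swinnerton-Dyer formula for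
ALL analytic-rank `≤ 1` elliptic curves over `ℚ` — "full BSD formula for every rank `≤ 1` curve in
class `C`" assembled STRICTLY from published theorems — so that the rank-`≤ 1` remainder becomes
exactly the CONSTRUCTION-SHAPED classes, which are TYPED (missing-input `Prop`s), NOT attempted.
This is not "finishing BSD". THEOREMS ONLY; the one NAMED FACT used (hypothesis `hK`) is the tree's
`kato_finite_chiPart_of_twistedLValue_ne_zero` (Kato, Astérisque 295, Cor. 14.3 (2); NOT proved in
the tree), displayed. Nothing about any particular curve is asserted; nothing is booked.

## What this file proves

Parts 1–2 turn ONE Mazur–Tate certificate (`μ(θ_m) = 0`, `λ(θ_m)` small; e.g. `λ♯ ≤ p − 2` and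
`λ♭ + p ≤ p(p−1)` at an odd supersingular `p`) into `L(E, χ, 1) ≠ 0` for every primitive even
`p`-power-order `χ` of conductor `p^{k+1}` at the layers `k` it reaches, and prove the relative
no-growth theorem over `(ℚ(ζ_M))^H` under Kato's Cor. 14.3 (2). This file assembles the two for the
`n`-th LAYER `ℚ_n` of the cyclotomic `ℤ_p`-extension, `p` odd: `ℚ_n` is the fixed field in
`ℚ(ζ_{p^{n+1}})` of the automorphisms `σ_η`, `η ∈ μ_{p−1} ⊂ ℤ_p^×` (the prime-to-`p` torsion), and the
characters of `Gal(ℚ(ζ_{p^{n+1}})/ℚ)` trivial on all `σ_η` are exactly the even `p`-power-order ones.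

* `apply_toZModPow_rootsOfUnity_of_even` — (any coefficient domain) an even `p`-power-order
  character kills the Teichmüller representatives (the tree's `apply_toZModPow_rootsOfUnity` is the
  `ℂ_p`-valued case); `even_and_orderOf_of_forall_apply_toZModPow` — the CONVERSE: a character mod
  `p^{n+e₀}` killing them is even and of `p`-power order (every unit is `η γ^s`,
  `exists_classMap_eq_of_isUnit`; `γ` has order `pⁿ`, `orderOf_cyclotomicGenerator`).
* `eq_one_of_orderOf_eq_prime_pow_of_coprime_totient` — a `p`-power-order character of a level
  whose totient is prime to `p` is trivial; hence (`two_le_of_primitiveCharacter_ne_one`) a non-trivial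
  even `p`-power-order character mod `p^{n+1}` (`p` odd) has conductor `p^{k+1}`, `1 ≤ k ≤ n`.
* `exists_continuation_ne_zero_of_forall_layer` — `L_{(p)}(f, χ, 1) ≠ 0` for every non-trivial even
  `p`-power-order `χ` mod `p^{n+1}` from the PRIMITIVE statements at the layers `1 ≤ k ≤ n`.
* **`exists_nsmul_mem_range_baseChange_layer_of_kato`** — under `hK`: for `p` odd, `E/ℚ` with newform
  `f`, if `L(f, χ, 1) ≠ 0` for all primitive even `p`-power-order `χ` of conductor `p^{k+1}`,
  `1 ≤ k ≤ n`, then every point of `E(ℚ(ζ_{p^{n+1}}))` fixed by all `σ_η` — i.e. every point of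
  `E(ℚ_n)` — has a positive multiple coming from `E(ℚ)`: **`rank E(ℚ_n) = rank E(ℚ)`**.
* **`exists_nsmul_mem_range_baseChange_layer_of_lam_le_of_kato`** — the same with the analytic input
  discharged by ONE pair of Mazur–Tate certificates: `p ≠ 2` good, `p ∣ a_p`, THE Sprung pair with
  `μ(L♯) = μ(L♭) = 0`, `λ(L♯) ≤ p − 2`, `λ(L♭) + p ≤ p(p−1)` (at `p = 3`: `λ♯ ≤ 1`, `λ♭ ≤ 3`) ⇒ for
  EVERY `n`, every point of `E(ℚ_n)` has a positive multiple in `E(ℚ)`. X8 reading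
  `X8.exists_nsmul_mem_range_baseChange_layer_of_kato`.
READING (census, kernel records, two engines; nothing booked): the 21 X8 rank-one pairs with
`(λ♯, λ♭) ∈ {(1,1), (1,3)}` (and the X7 pairs with such certificates) have, granted Kato's Cor. 14.3 (2),
rank `E(ℚ_n) = 1` at EVERY layer — Kurihara–Pollack's `e_n = 0`, `n ≥ 1`. Not a BSD statement over `ℚ`.
References: Kato, Astérisque 295, Cor. 14.3 (2), Thm. 14.4; Washington GTM 83 §7.2; MTT 1986 §I.13;
Kurihara–Pollack 2007 §0.3, Prop. 3.1. Memo: `HOME/b2b-bsdres-additive-p3/X8-ROUTE-B.md` §11.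
-/

set_option autoImplicit false

noncomputable section

open scoped Classical MatrixGroups ModularForm

open CongruenceSubgroup Polynomial WeierstrassCurve WeierstrassCurve.Affine
  Literature.NumberTheory.EllipticCurves
  Literature.NumberTheory.EllipticCurves.ModularForms
  Literature.NumberTheory.EllipticCurves.Sprung2017
  Literature.NumberTheory.EllipticCurves.Rank1Residual
  Summit.BirchSwinnertonDyer.Rank1Residual.X1.MuLambda

namespace Summit.BirchSwinnertonDyer.Rank1Residual.Supersingular

/-! ## §1. Characters of `Γ` among the Dirichlet characters modulo `p^{n+e₀}` -/

section Gamma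

variable {p : ℕ} [hp : Fact p.Prime] {R : Type*} [CommRing R]

/-- **Even `p`-power-order characters kill the Teichmüller representatives** (any coefficient
domain `R`; the tree's `apply_toZModPow_rootsOfUnity` is `R = ℂ_p`): `χ(η mod p^m) = 1` for
`η ∈ μ_τ(ℤ_p)` — for odd `p` the order of `χ(η)` divides `gcd(p−1, p^j) = 1`; for `p = 2`, `η = ±1`.
[cite: MazurTateTeitelbaum1986Invent, §I.13] -/
theorem apply_toZModPow_rootsOfUnity_of_even {m : ℕ} (χ : DirichletCharacter R (p ^ m))
    (heven : χ.Even) (hord : ∃ j : ℕ, orderOf χ = p ^ j)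
    (w : rootsOfUnity (torsionOrder p) ℤ_[p]) :
    χ (PadicInt.toZModPow m ((w : ℤ_[p]ˣ) : ℤ_[p])) = 1 := by
  obtain ⟨j, hj⟩ := hord
  have hwτ := rootsOfUnity_pow_torsionOrder p w
  by_cases h2 : p = 2
  · have hτ : torsionOrder p = 2 := by rw [torsionOrder_eq, if_pos h2]
    have hsq : ((w : ℤ_[p]ˣ) : ℤ_[p]) * ((w : ℤ_[p]ˣ) : ℤ_[p]) = 1 := by
      rw [← sq, ← hτ]; exact hwτ
    rcases mul_self_eq_one_iff.mp hsq with h | h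
    · rw [h, map_one, map_one]
    · rw [h, map_neg, map_one]; exact heven
  · have hτ : torsionOrder p = p - 1 := by rw [torsionOrder_eq, if_neg h2]
    obtain ⟨v, hv⟩ : IsUnit (PadicInt.toZModPow m ((w : ℤ_[p]ˣ) : ℤ_[p])) :=
      (Units.isUnit _).map _
    have h1 : χ (v : ZMod (p ^ m)) ^ (p - 1) = 1 := by
      rw [← map_pow, hv, ← map_pow, ← hτ, hwτ, map_one, map_one]
    have h2' : χ (v : ZMod (p ^ m)) ^ (p ^ j) = 1 := by
      rw [← MulChar.pow_apply_coe, ← hj, pow_orderOf_eq_one, MulChar.one_apply_coe]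
    have hcop : Nat.Coprime (p - 1) (p ^ j) :=
      Nat.Coprime.pow_right j ((Nat.coprime_self_sub_left hp.out.one_le).mpr (Nat.coprime_one_left p))
    have h := pow_gcd_eq_one.mpr ⟨h1, h2'⟩
    rw [hcop.gcd_eq_one, pow_one] at h
    rw [← hv, h]

/-- **Conversely, a character mod `p^{n+e₀}` killing the Teichmüller representatives is a character
of `Γ`**: it is even (`−1 ∈ μ_τ`, tree `neg_one_mem_rootsOfUnity_torsionOrder`) and of `p`-power order (`χ^{pⁿ} = 1`: every unit is `η γ^s`,
`exists_classMap_eq_of_isUnit`, and `γ^{pⁿ} ≡ 1`, `orderOf_cyclotomicGenerator`) — Washington §7.2,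
`ℤ_p^× = μ_τ × γ^{ℤ_p}`. [cite: MazurTateTeitelbaum1986Invent, §I.13] -/
theorem even_and_orderOf_of_forall_apply_toZModPow {n : ℕ}
    (χ : DirichletCharacter R (p ^ (n + cyclotomicExponent p)))
    (h : ∀ w : rootsOfUnity (torsionOrder p) ℤ_[p],
      χ (PadicInt.toZModPow (n + cyclotomicExponent p) ((w : ℤ_[p]ˣ) : ℤ_[p])) = 1) :
    χ.Even ∧ ∃ j : ℕ, orderOf χ = p ^ j := by
  haveI : NeZero (p ^ (n + cyclotomicExponent p)) := ⟨pow_ne_zero _ hp.out.ne_zero⟩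
  refine ⟨?_, ?_⟩
  · have h1 := h ⟨-1, Literature.NumberTheory.EllipticCurves.neg_one_mem_rootsOfUnity_torsionOrder p⟩
    rwa [Units.val_neg, Units.val_one, map_neg, map_one] at h1
  · -- `χ ^ pⁿ = 1`
    have hγ : (cyclotomicGenerator p : ZMod (p ^ (n + cyclotomicExponent p))) ^ p ^ n = 1 := by
      have h1 := pow_orderOf_eq_one (cyclotomicGenerator p : ZMod (p ^ (n + cyclotomicExponent p)))
      rwa [orderOf_cyclotomicGenerator] at h1
    have hpow : χ ^ (p ^ n) = 1 := by
      refine MulChar.ext fun u ↦ ?_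
      obtain ⟨w, s, hws⟩ := exists_classMap_eq_of_isUnit (p := p) n u.isUnit
      rw [MulChar.pow_apply_coe, MulChar.one_apply_coe, ← hws, map_mul, h w, one_mul, map_pow,
        ← pow_mul, mul_comm, pow_mul, ← map_pow, hγ, map_one, one_pow]
    have hdvd : orderOf χ ∣ p ^ n := orderOf_dvd_of_pow_eq_one hpow
    obtain ⟨j, -, hj⟩ := (Nat.dvd_prime_pow hp.out).mp hdvd
    exact ⟨j, hj⟩

omit hp in
/-- **A `p`-power-order character of a level with totient prime to `p` is trivial** (`u^{φ(c)} = 1`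
for every unit, `ZMod.pow_totient`, and `gcd(φ(c), p^j) = 1`). [folklore] -/
theorem eq_one_of_orderOf_eq_prime_pow_of_coprime_totient {c : ℕ} [NeZero c]
    (χ : DirichletCharacter R c) {j : ℕ} (hj : orderOf χ = p ^ j)
    (hcop : Nat.Coprime (Nat.totient c) p) : χ = 1 := by
  refine MulChar.ext fun u ↦ ?_
  rw [MulChar.one_apply_coe]
  have h1 : χ (u : ZMod c) ^ Nat.totient c = 1 := by
    rw [← map_pow, ← Units.val_pow_eq_pow_val, ZMod.pow_totient, Units.val_one, map_one]
  have h2 : χ (u : ZMod c) ^ (p ^ j) = 1 := by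
    rw [← MulChar.pow_apply_coe, ← hj, pow_orderOf_eq_one, MulChar.one_apply_coe]
  have h := pow_gcd_eq_one.mpr ⟨h1, h2⟩
  rwa [(hcop.pow_right j).gcd_eq_one, pow_one] at h

/-- **The conductor exponent of a non-trivial `p`-power-order character is `≥ 2`**: if
`χ` mod `p^m` has `p`-power order and conductor `p^c` with `c ≤ 1`, then `χ = 1`
(`φ(1) = 1`, `φ(p) = p − 1` are prime to `p`). [folklore] -/
theorem two_le_of_primitiveCharacter_ne_one {m : ℕ}
    (χ : DirichletCharacter R (p ^ m)) (hord : ∃ j : ℕ, orderOf χ = p ^ j) (hχ : χ ≠ 1)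
    {c : ℕ} (hc : χ.conductor = p ^ c) : 2 ≤ c := by
  haveI : NeZero (p ^ m) := ⟨pow_ne_zero _ hp.out.ne_zero⟩
  haveI : NeZero χ.conductor := ⟨χ.conductor_ne_zero⟩
  by_contra hlt
  rw [not_le] at hlt
  obtain ⟨j, hj⟩ := hord
  -- the primitive character has the same order and lives at a level with totient prime to `p`
  have hord0 : orderOf χ.primitiveCharacter = p ^ j := by
    rw [← hj]
    conv_rhs => rw [← DirichletCharacter.changeLevel_primitiveCharacter χ]
    exact (orderOf_injective (DirichletCharacter.changeLevel χ.conductor_dvd_level)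
      (DirichletCharacter.changeLevel_injective χ.conductor_dvd_level) _).symm
  have hcop : Nat.Coprime (Nat.totient χ.conductor) p := by
    rw [hc]
    interval_cases c
    · rw [pow_zero, Nat.totient_one]; exact Nat.coprime_one_left p
    · rw [pow_one, Nat.totient_prime hp.out]
      exact (Nat.coprime_self_sub_left hp.out.one_le).mpr (Nat.coprime_one_left p)
  have h0 : χ.primitiveCharacter = 1 :=
    eq_one_of_orderOf_eq_prime_pow_of_coprime_totient χ.primitiveCharacter hord0 hcop
  apply hχ
  rw [← DirichletCharacter.changeLevel_primitiveCharacter χ, h0, DirichletCharacter.changeLevel_one]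

omit hp in
/-- `changeLevel` preserves parity. [folklore] -/
theorem even_changeLevel_iff {d M : ℕ} [NeZero M] (hd : d ∣ M) (χ : DirichletCharacter R d) :
    (DirichletCharacter.changeLevel hd χ).Even ↔ χ.Even := by
  haveI : NeZero d := ⟨fun h ↦ NeZero.ne M (Nat.eq_zero_of_zero_dvd (h ▸ hd))⟩
  change DirichletCharacter.changeLevel hd χ (-1) = 1 ↔ χ (-1) = 1
  rw [show (-1 : ZMod M) = ((-1 : (ZMod M)ˣ) : ZMod M) by rw [Units.val_neg, Units.val_one],
    DirichletCharacter.changeLevel_eq_cast_of_dvd χ hd, Units.val_neg, Units.val_one, ZMod.cast_neg hd,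
    ZMod.cast_one hd]

omit hp in
/-- `changeLevel` preserves the order of a character. [folklore] -/
theorem orderOf_changeLevel {d M : ℕ} [NeZero M] (hd : d ∣ M) (χ : DirichletCharacter R d) :
    orderOf (DirichletCharacter.changeLevel hd χ) = orderOf χ :=
  orderOf_injective (DirichletCharacter.changeLevel hd) (DirichletCharacter.changeLevel_injective hd) χ

end Gamma

/-! ## §2. `L(f, χ, 1) ≠ 0` for ALL non-trivial characters of `Γ_n` from the primitive layers -/

section Layers

variable {W : WeierstrassCurve ℚ} [W.IsElliptic] {N : ℕ} [NeZero N] {f : CuspForm (Gamma0 N) 2}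
  {p : ℕ} [hp : Fact p.Prime]

/-- **From the primitive layers to every character of `Γ_n`.** `p` odd, `f` the newform of `E`:
if for every `1 ≤ k ≤ n` and every primitive even `p`-power-order `χ` mod `p^{k+1}` every entire
continuation of `∑ χ(n) aₙ n⁻ˢ` is non-zero at `1`, then for every NON-TRIVIAL even `p`-power-order
`χ` mod `p^{n+1}` the series `∑ χ(n) aₙ n⁻ˢ` has an entire continuation non-zero at `1`: pass to the
primitive character (`exists_continuation_iff_primitive`), whose conductor is `p^{k+1}` with
`1 ≤ k ≤ n` (`two_le_of_primitiveCharacter_ne_one`), re-levelled to `p^{k+e₀}`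
(`exists_continuation_changeLevel_iff`, `conductor_changeLevel`). [folklore] -/
theorem exists_continuation_ne_zero_of_forall_layer (hp2 : p ≠ 2) (hf : IsNewformOf W f) {n : ℕ}
    (hvan : ∀ k : ℕ, 0 < k → k ≤ n →
      ∀ χ : DirichletCharacter ℂ (p ^ (k + cyclotomicExponent p)), χ.IsPrimitive → χ.Even →
        (∃ j : ℕ, orderOf χ = p ^ j) → ∀ L : ℂ → ℂ, Differentiable ℂ L →
          (∀ s : ℂ, 2 < s.re → L s = twistedLSeries f χ s) → L 1 ≠ 0)
    (χ : DirichletCharacter ℂ (p ^ (n + cyclotomicExponent p))) (hχ1 : χ ≠ 1) (hev : χ.Even)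
    (hord : ∃ j : ℕ, orderOf χ = p ^ j) :
    ∃ L : ℂ → ℂ, Differentiable ℂ L ∧
      (∀ s : ℂ, 2 < s.re → L s = twistedLSeries f χ s) ∧ L 1 ≠ 0 := by
  have he : cyclotomicExponent p = 1 := if_neg hp2
  haveI : NeZero (p ^ (n + cyclotomicExponent p)) := ⟨pow_ne_zero _ hp.out.ne_zero⟩
  haveI : NeZero χ.conductor := ⟨χ.conductor_ne_zero⟩
  -- conductor `p^c`, `2 ≤ c ≤ n + 1`
  obtain ⟨c, hcle, hc⟩ := (Nat.dvd_prime_pow hp.out).mp χ.conductor_dvd_level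
  have h2c : 2 ≤ c := two_le_of_primitiveCharacter_ne_one χ hord hχ1 hc
  obtain ⟨k, rfl⟩ : ∃ k, c = k + cyclotomicExponent p := ⟨c - 1, by rw [he]; omega⟩
  have hk0 : 0 < k := by rw [he] at h2c; omega
  have hkn : k ≤ n := by omega
  haveI : NeZero (p ^ (k + cyclotomicExponent p)) := ⟨pow_ne_zero _ hp.out.ne_zero⟩
  -- the primitive character, re-levelled to `p^{k+e₀}`
  set ψ : DirichletCharacter ℂ (p ^ (k + cyclotomicExponent p)) :=
    DirichletCharacter.changeLevel (dvd_of_eq hc) χ.primitiveCharacter with hψ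
  have hψprim : ψ.IsPrimitive := by
    rw [DirichletCharacter.isPrimitive_def, hψ, DirichletCharacter.conductor_changeLevel,
      (DirichletCharacter.isPrimitive_def _).mp χ.primitiveCharacter_isPrimitive, hc]
  have hψev : ψ.Even := by
    rw [hψ, even_changeLevel_iff]
    have h := (even_changeLevel_iff χ.conductor_dvd_level χ.primitiveCharacter).mp
    rw [DirichletCharacter.changeLevel_primitiveCharacter] at h
    exact h hev
  have hψord : ∃ j : ℕ, orderOf ψ = p ^ j := by
    obtain ⟨j, hj⟩ := hord
    refine ⟨j, ?_⟩
    rw [hψ, orderOf_changeLevel, ← hj]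
    conv_rhs => rw [← DirichletCharacter.changeLevel_primitiveCharacter χ]
    rw [orderOf_changeLevel]
  -- non-vanishing for `ψ`, transported back to `χ`
  obtain ⟨L, hLd, hLs⟩ := exists_differentiable_eq_twistedLSeries_holds f ψ
  have hL1 : L 1 ≠ 0 := hvan k hk0 hkn ψ hψprim hψev hψord L hLd hLs
  have h1 : ∃ L₀ : ℂ → ℂ, Differentiable ℂ L₀ ∧
      (∀ s : ℂ, 2 < s.re → L₀ s = twistedLSeries f χ.primitiveCharacter s) ∧ L₀ 1 ≠ 0 :=
    (exists_continuation_changeLevel_iff hf (dvd_of_eq hc) χ.primitiveCharacter).mp ⟨L, hLd, hLs, hL1⟩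
  exact (exists_continuation_iff_primitive hf χ).mpr h1

end Layers

/-! ## §3. The layer `ℚ_n`: points fixed by the `σ_η`, `η ∈ μ_τ`, under Kato's Cor. 14.3 (2) -/

section Tower

variable {W : WeierstrassCurve ℚ} [W.IsElliptic] {N : ℕ} [NeZero N] {f : CuspForm (Gamma0 N) 2}
  {p : ℕ} [hp : Fact p.Prime]

set_option backward.isDefEq.respectTransparency false in
/-- **No Mordell–Weil growth in `ℚ_n` from the primitive layers (under Kato's Cor. 14.3 (2)).**
`p` odd, `E = W/ℚ` with newform `f`, `K = ℚ(ζ_{p^{n+1}})`, `σ_u ∈ Gal(K/ℚ)` the automorphism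
`ζ ↦ ζ^u` (`autEquivPow`). Assume the vendored `hK` and: for all `1 ≤ k ≤ n` and all primitive even
`p`-power-order `χ` mod `p^{k+1}`, every entire continuation of `∑ χ(n) aₙ n⁻ˢ` is `≠ 0` at `1`.
Then every `P ∈ E(K)` fixed by the `σ_{η mod p^{n+1}}`, `η ∈ μ_{p−1}(ℤ_p)` — i.e. every point of
`E(ℚ_n)`, `ℚ_n = K^{μ_{p−1}}` the `n`-th layer of the cyclotomic `ℤ_p`-extension — has a positive
multiple in the image of `E(ℚ)`. (The characters trivial on these `σ_η` are even of `p`-power order,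
`even_and_orderOf_of_forall_apply_toZModPow`; then §2 and `exists_nsmul_mem_range_baseChange_of_kato`.)
[cite: Kato2004Asterisque, Cor. 14.3 (2) (p. 235) and Thm. 14.4 (p. 236)] -/
theorem exists_nsmul_mem_range_baseChange_layer_of_kato
    (hK : kato_finite_chiPart_of_twistedLValue_ne_zero) (hp2 : p ≠ 2) (hf : IsNewformOf W f)
    {n : ℕ} [NeZero (p ^ (n + cyclotomicExponent p))]
    [DecidableEq (CyclotomicField (p ^ (n + cyclotomicExponent p)) ℚ)]
    (hvan : ∀ k : ℕ, 0 < k → k ≤ n →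
      ∀ χ : DirichletCharacter ℂ (p ^ (k + cyclotomicExponent p)), χ.IsPrimitive → χ.Even →
        (∃ j : ℕ, orderOf χ = p ^ j) → ∀ L : ℂ → ℂ, Differentiable ℂ L →
          (∀ s : ℂ, 2 < s.re → L s = twistedLSeries f χ s) → L 1 ≠ 0)
    {P : (W.baseChange (CyclotomicField (p ^ (n + cyclotomicExponent p)) ℚ)).toAffine.Point}
    (hP : ∀ σ : CyclotomicField (p ^ (n + cyclotomicExponent p)) ℚ ≃ₐ[ℚ]
        CyclotomicField (p ^ (n + cyclotomicExponent p)) ℚ,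
      (∃ w : rootsOfUnity (torsionOrder p) ℤ_[p],
        IsCyclotomicExtension.autEquivPow (CyclotomicField (p ^ (n + cyclotomicExponent p)) ℚ)
            (cyclotomic.irreducible_rat (NeZero.pos (p ^ (n + cyclotomicExponent p)))) σ =
          Units.map (PadicInt.toZModPow (n + cyclotomicExponent p)).toMonoidHom (w : ℤ_[p]ˣ)) →
      Point.map (W' := W.toAffine) (σ : CyclotomicField (p ^ (n + cyclotomicExponent p)) ℚ →ₐ[ℚ]
        CyclotomicField (p ^ (n + cyclotomicExponent p)) ℚ) P = P) :
    ∃ m : ℕ, 0 < m ∧ m • P ∈ Set.range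
      (Point.baseChange (W' := W.toAffine) ℚ (CyclotomicField (p ^ (n + cyclotomicExponent p)) ℚ)) := by
  -- `H` = the automorphisms `σ` acting on `μ_{p^{n+1}}` through a Teichmüller unit
  refine exists_nsmul_mem_range_baseChange_of_kato hK W hf
    {σ | ∃ w : rootsOfUnity (torsionOrder p) ℤ_[p],
      IsCyclotomicExtension.autEquivPow (CyclotomicField (p ^ (n + cyclotomicExponent p)) ℚ)
          (cyclotomic.irreducible_rat (NeZero.pos (p ^ (n + cyclotomicExponent p)))) σ =
        Units.map (PadicInt.toZModPow (n + cyclotomicExponent p)).toMonoidHom (w : ℤ_[p]ˣ)}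
    (fun χ hχ1 hχH ↦ ?_) (fun σ hσ ↦ hP σ hσ)
  -- a character trivial on `H` kills the Teichmüller representatives, so is a character of `Γ`
  have hkill : ∀ w : rootsOfUnity (torsionOrder p) ℤ_[p],
      χ (PadicInt.toZModPow (n + cyclotomicExponent p) ((w : ℤ_[p]ˣ) : ℤ_[p])) = 1 := by
    intro w
    set e := IsCyclotomicExtension.autEquivPow (CyclotomicField (p ^ (n + cyclotomicExponent p)) ℚ)
      (cyclotomic.irreducible_rat (NeZero.pos (p ^ (n + cyclotomicExponent p)))) with he
    have h1 := hχH (e.symm (Units.map (PadicInt.toZModPow (n + cyclotomicExponent p)).toMonoidHom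
      (w : ℤ_[p]ˣ))) ⟨w, by rw [MulEquiv.apply_symm_apply]⟩
    have h2 := congrArg (fun u : ℂˣ ↦ (u : ℂ)) h1
    simp only [Units.val_one] at h2
    rw [coe_cyclotomicCharacterOf_apply, ← he, MulEquiv.apply_symm_apply, Units.coe_map] at h2
    exact h2
  obtain ⟨hev, hord⟩ := even_and_orderOf_of_forall_apply_toZModPow χ hkill
  exact exists_continuation_ne_zero_of_forall_layer hp2 hf hvan χ hχ1 hev hord

set_option backward.isDefEq.respectTransparency false in
/-- **… with the analytic input discharged by ONE pair of Mazur–Tate certificates.** `p ≠ 2`,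
`E = W` globally minimal with good reduction at `p` and `p ∣ a_p`, `f` its newform, THE Sprung pair
`(L♯, L♭)` with `L♯, L♭ ≠ 0`, `μ(L♯) = μ(L♭) = 0`, `λ(L♯) ≤ p − 2` and `λ(L♭) + p ≤ p(p−1)` (at `p = 3`:
`λ♯ ≤ 1`, `λ♭ ≤ 3`). Then, granted Kato's Cor. 14.3 (2) (`hK`), for EVERY `n` every point of `E(ℚ_n)`
(= of `E(ℚ(ζ_{p^{n+1}}))` fixed by the `σ_η`) has a positive multiple in the image of `E(ℚ)`:
`rank E(ℚ_n) = rank E(ℚ)` along the whole cyclotomic `ℤ_p`-tower.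
[cite: Kato2004Asterisque, Cor. 14.3 (2) (p. 235)] [cite: Sprung2017, §3 and Cor. 3.6] -/
theorem exists_nsmul_mem_range_baseChange_layer_of_lam_le_of_kato
    (hK : kato_finite_chiPart_of_twistedLValue_ne_zero) [W.IsGloballyMinimal] (hp2 : p ≠ 2)
    (hf : IsNewformOf W f) (hgood : W.HasGoodReductionAtPrime p) (hap : (p : ℤ) ∣ W.frobeniusTrace p)
    {Lsharp Lflat : IwasawaAlgebra p} (hSP : IsSprungPair f p (W.frobeniusTrace p) Lsharp Lflat)
    (hLs0 : Lsharp ≠ 0) (hμs : mu Lsharp = 0) (hsmalls : lam Lsharp + 2 ≤ p)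
    (hLf0 : Lflat ≠ 0) (hμf : mu Lflat = 0) (hsmallf : lam Lflat + p ≤ p * (p - 1))
    {n : ℕ} [NeZero (p ^ (n + cyclotomicExponent p))]
    [DecidableEq (CyclotomicField (p ^ (n + cyclotomicExponent p)) ℚ)]
    {P : (W.baseChange (CyclotomicField (p ^ (n + cyclotomicExponent p)) ℚ)).toAffine.Point}
    (hP : ∀ σ : CyclotomicField (p ^ (n + cyclotomicExponent p)) ℚ ≃ₐ[ℚ]
        CyclotomicField (p ^ (n + cyclotomicExponent p)) ℚ,
      (∃ w : rootsOfUnity (torsionOrder p) ℤ_[p],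
        IsCyclotomicExtension.autEquivPow (CyclotomicField (p ^ (n + cyclotomicExponent p)) ℚ)
            (cyclotomic.irreducible_rat (NeZero.pos (p ^ (n + cyclotomicExponent p)))) σ =
          Units.map (PadicInt.toZModPow (n + cyclotomicExponent p)).toMonoidHom (w : ℤ_[p]ˣ)) →
      Point.map (W' := W.toAffine) (σ : CyclotomicField (p ^ (n + cyclotomicExponent p)) ℚ →ₐ[ℚ]
        CyclotomicField (p ^ (n + cyclotomicExponent p)) ℚ) P = P) :
    ∃ m : ℕ, 0 < m ∧ m • P ∈ Set.range
      (Point.baseChange (W' := W.toAffine) ℚ (CyclotomicField (p ^ (n + cyclotomicExponent p)) ℚ)) := by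
  refine exists_nsmul_mem_range_baseChange_layer_of_kato hK hp2 hf (fun k hk _ χ hχ hev hord L hLd hL ↦ ?_)
    hP
  rcases Nat.even_or_odd k with hke | hko
  · exact forall_even_twistedLValue_ne_zero_of_lam_flat_le hp2 hf hgood hap hSP hLf0 hμf hsmallf hke hk
      χ hχ hev hord hLd hL
  · exact forall_odd_twistedLValue_ne_zero_of_lam_sharp_le hp2 hf hgood hap hSP hLs0 hμs hsmalls hko
      χ hχ hev hord hLd hL

end Tower

/-! ## §4. X8 reading -/

section X8

variable {W : WeierstrassCurve ℚ} [W.IsElliptic] [W.IsGloballyMinimal] {N : ℕ} [NeZero N]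
  {f : CuspForm (Gamma0 N) 2}

set_option backward.isDefEq.respectTransparency false in
/-- **X8 (`p = 3`, `a_3 = ±3`), certificates `λ♯ ≤ 1` and `λ♭ ≤ 3` (`μ = 0`): granted Kato's
Cor. 14.3 (2), every point of `E(ℚ_n)` — the points of `E(ℚ(ζ_{3^{n+1}}))` fixed by `ζ ↦ ζ^{-1}`·(the
Teichmüller lifts) — has a positive multiple coming from `E(ℚ)`, for every `n`.** On the census this is
the case for the 21 rank-one pairs with `(λ♯, λ♭) ∈ {(1,1), (1,3)}` (kernel records `MazurTateRecords`):
there `rank E(ℚ_n) = 1` for all `n` (Gross–Zagier–Kolyvagin over `ℚ`). Nothing booked; X8 stays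
CONSTRUCTION-SHAPED. [cite: Kato2004Asterisque, Cor. 14.3 (2) (p. 235)] [cite: Sprung2017, §3 and Cor. 3.6] -/
theorem X8.exists_nsmul_mem_range_baseChange_layer_of_kato {p : ℕ} [Fact p.Prime]
    (hK : kato_finite_chiPart_of_twistedLValue_ne_zero) (hX : ClassX8 W p) (hf : IsNewformOf W f)
    {Lsharp Lflat : IwasawaAlgebra p} (hSP : IsSprungPair f p (W.frobeniusTrace p) Lsharp Lflat)
    (hLs0 : Lsharp ≠ 0) (hμs : mu Lsharp = 0) (h1 : lam Lsharp ≤ 1)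
    (hLf0 : Lflat ≠ 0) (hμf : mu Lflat = 0) (h3 : lam Lflat ≤ 3)
    {n : ℕ} [NeZero (p ^ (n + cyclotomicExponent p))]
    [DecidableEq (CyclotomicField (p ^ (n + cyclotomicExponent p)) ℚ)]
    {P : (W.baseChange (CyclotomicField (p ^ (n + cyclotomicExponent p)) ℚ)).toAffine.Point}
    (hP : ∀ σ : CyclotomicField (p ^ (n + cyclotomicExponent p)) ℚ ≃ₐ[ℚ]
        CyclotomicField (p ^ (n + cyclotomicExponent p)) ℚ,
      (∃ w : rootsOfUnity (torsionOrder p) ℤ_[p],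
        IsCyclotomicExtension.autEquivPow (CyclotomicField (p ^ (n + cyclotomicExponent p)) ℚ)
            (cyclotomic.irreducible_rat (NeZero.pos (p ^ (n + cyclotomicExponent p)))) σ =
          Units.map (PadicInt.toZModPow (n + cyclotomicExponent p)).toMonoidHom (w : ℤ_[p]ˣ)) →
      Point.map (W' := W.toAffine) (σ : CyclotomicField (p ^ (n + cyclotomicExponent p)) ℚ →ₐ[ℚ]
        CyclotomicField (p ^ (n + cyclotomicExponent p)) ℚ) P = P) :
    ∃ m : ℕ, 0 < m ∧ m • P ∈ Set.range
      (Point.baseChange (W' := W.toAffine) ℚ (CyclotomicField (p ^ (n + cyclotomicExponent p)) ℚ)) := by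
  obtain ⟨hp3, ⟨hgood, hap⟩, -⟩ := hX
  subst hp3
  exact exists_nsmul_mem_range_baseChange_layer_of_lam_le_of_kato hK (show (3 : ℕ) ≠ 2 by decide) hf
    hgood hap hSP hLs0 hμs (by omega) hLf0 hμf (by omega) hP

end X8

end Summit.BirchSwinnertonDyer.Rank1Residual.Supersingular

end
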